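import Summits.CriticalPhenomena.Ising3DConformalLimit.Theorems.IsingEuclidUpgradeR4NonGaussianBackboneCutDecomposition
import HarnessLib

/-!
# Crux `IsingEuclidUpgradeR4NonGaussian` (stmt-CriticalPhenomena-0636), line `partner-backbone-cut`:
# the EXACT NECESSARY CONDITION — the intersection probability is at most the expected cut
# `σσ`-capacity of the backbone's 1-neighbourhood

The line bets on a LOWER bound for Aizenman's intersection probability
`P^{xy,zt}[x ↔ z in n₁+n₂]` through contacts of the cluster of `x` with the explored backbone `δ` of the
partner's current (Stubs 1–2, landed; Stubs 3–4, open). This file proves the converse bookkeeping, the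
card's "exact necessary condition" `P[x ↔ z | δ] ≤ E[Ñ_δ | δ]`:

* `connMass_le_sum_cutFirstMoment_nbhd` — for every finite graph, `β ≥ 0`, injective ranking,
  `P^{xy,zt}[x ↔ z] · Z[xy]Z[zt] ≤ Σ_{δ ∈ finalStates(z→t)} patSum(δ) · Σ_{w ∈ W_δ} Z_{H_δ}[{x}Δ{w}] · Z[{y}Δ{w}]`
  with `W_δ = backboneNbhd δ` (visited sites and the endpoints of the examined bonds) and `H_δ` the cut
  graph: i.e. `P[x ↔ z] ≤ E^{zt}[Σ_{w ∈ W_δ} ⟨σ_xσ_w⟩_{H_δ}⟨σ_wσ_y⟩/⟨σ_xσ_y⟩]`. So a proof of the crux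
  FORCES the backbone of a single sourced critical current (thickened by one lattice unit) to have
  cut `σσ`-capacity bounded below in mean — the "(B1) no total shadowing" clause of the open Stub 4 is
  necessary, and dropping the cut (`Z_{H_δ} ≤ Z`, Griffiths) and bounding `P[w near the backbone]` by the
  chain rule returns the tree-diagram bound.
* `sum_patSum_mul_ecurrentSum_koff_empty` — the normalisation `Σ_δ patSum(δ)·Z_{K off δ.used}[∅] = Z[{z}Δ{t}]`,
  which reads `roughMass/Z[zt]` of the open Stub 3 as the `P^{zt}`-probability of a rough backbone.

Mechanism: first entrance. A path from `x` to `z` carrying positive total current must enter `W_δ`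
(it ends at `z ∈ δ.vis`); before its first vertex in `W_δ` it uses no examined bond (both ends of an
examined bond lie in `W_δ`), so it is a path of the cut graph carrying the current `n₁ + m`, `m` the
remainder of `n₂` off `δ.used`; then the functional chain rule (`tsum_sources_inCyl_mul_eq_of_mem_finalStates`)
and the exact cut one-point function (`tsum_cutPairWeight_mul_indicator_connIn`). Dimension-free.

References: M. Aizenman, Comm. Math. Phys. 86 (1982) §5 (tree-diagram bound), §9;
M. Aizenman, H. Duminil-Copin, Ann. Math. 194 (2021) = arXiv:1912.07973 §3–§4.
-/

noncomputable section

namespace Summit.CriticalPhenomena.Ising3DConformalLimit.Cruxes.IsingEuclidUpgradeR4NonGaussian.PartnerBackboneCut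

open Literature.Probability Literature.Probability.LatticeModels Literature.Probability.Percolation
open MeasureTheory Filter Finset Current
open scoped Topology symmDiff ENNReal

variable {V : Type*} [Fintype V] [DecidableEq V] {G : SimpleGraph V} [DecidableRel G.Adj]

/-! ### The normalisation of the backbone decomposition -/

/-- **Total mass of the backbone decomposition**: `Σ_{δ ∈ finalStates(z→t)} patSum(δ) · Z_{K off δ.used}[∅]
= Z[{z}Δ{t}]` — the cylinders of the final states partition the `{z,t}`-currents (Aizenman 1982, (9.8)
summed over walks). [cite: AizenmanCMP1982, Prop. 9.2, eq. (9.8)] -/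
theorem sum_patSum_mul_ecurrentSum_koff_empty {K : G.edgeFinset → ℝ} (hK : ∀ e, 0 ≤ K e)
    {rk : G.edgeFinset → ℕ} (hrk : Function.Injective rk) (z t : V) :
    ∑ δ ∈ finalStates rk {t} z t, patSum K δ * ecurrentSum (koff K δ.used) ∅ =
      ecurrentSum K ({z} ∆ {t}) := by
  have hδsum : ∀ δ ∈ finalStates rk {t} z t, patSum K δ * ecurrentSum (koff K δ.used) ∅ =
      ∑' n : Current G, (if n.sources = {z} ∆ {t} then n.eweight K else 0) *
        (if InCyl δ n then 1 else 0) := by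
    intro δ hδ
    rw [tsum_inCyl_of_mem_finalStates hK hrk hδ ({z} ∆ {t})]
    congr 2
    rw [symmDiff_self]; rfl
  rw [Finset.sum_congr rfl hδsum, ← tsum_mul_indicator_pos_eq_sum (Y := {t}) hrk _ z t]
  unfold ecurrentSum
  refine tsum_congr fun n => ?_
  by_cases hs : n.sources = {z} ∆ {t}
  · rw [if_pos hs, if_pos (explore_done_of_sources_eq hrk hs).2, mul_one]
  · rw [if_neg hs, zero_mul]

/-! ### The 1-neighbourhood of a backbone state and first entrance -/

/-- **The 1-neighbourhood of a backbone state**: the visited sites together with both endpoints of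
every examined bond (`δ.vis ∪ ⋃_{e ∈ δ.used} ends(e)`). [folklore] -/
def backboneNbhd (δ : XState G) : Finset V :=
  δ.vis ∪ δ.used.biUnion fun e => (e : Sym2 V).toFinset

/-- Visited sites lie in the neighbourhood. [folklore] -/
theorem mem_backboneNbhd_of_mem_vis {δ : XState G} {v : V} (hv : v ∈ δ.vis) : v ∈ backboneNbhd δ :=
  Finset.mem_union_left _ hv

/-- Endpoints of examined bonds lie in the neighbourhood. [folklore] -/
theorem mem_backboneNbhd_of_mem_used {δ : XState G} {e : G.edgeFinset} (he : e ∈ δ.used) {v : V}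
    (hv : v ∈ (e : Sym2 V)) : v ∈ backboneNbhd δ :=
  Finset.mem_union_right _ (Finset.mem_biUnion.2 ⟨e, he, Sym2.mem_toFinset.2 hv⟩)

omit [Fintype V] [DecidableEq V] [DecidableRel G.Adj] in
/-- **First entrance** (pure graph theory): if every edge of `Γ` issuing from a vertex outside `W` is
an edge of `Γ'`, then a `Γ`-walk from `a` to a vertex of `W` yields a vertex of `W` that is
`Γ'`-reachable from `a` (its first vertex in `W`). [folklore] -/
theorem exists_mem_reachable_of_walk {Γ Γ' : SimpleGraph V} {W : Finset V}
    (hadj : ∀ a b, Γ.Adj a b → a ∉ W → Γ'.Adj a b) :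
    ∀ {a b : V}, Γ.Walk a b → b ∈ W → ∃ w ∈ W, Γ'.Reachable a w := by
  intro a b p
  induction p with
  | nil => exact fun hb => ⟨_, hb, SimpleGraph.Reachable.refl _⟩
  | @cons u v c huv _ ih =>
    intro hc
    by_cases hu : u ∈ W
    · exact ⟨u, hu, SimpleGraph.Reachable.refl _⟩
    · obtain ⟨w, hw, hr⟩ := ih hc
      exact ⟨w, hw, (hadj u v huv hu).reachable.trans hr⟩

/-- **A connection forces a contact with the neighbourhood.** If `δ` is the walk of `n₂` from `z`
with target `{t}` and `x ↔ z` in the trace of `n₁ + n₂`, then some `w ∈ backboneNbhd δ` is joined to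
`x` through cut-graph bonds carrying positive current `n₂|_{used(δ)ᶜ} + n₁`. [cite: AizenmanCMP1982, §9] -/
theorem exists_mem_backboneNbhd_connIn {rk : G.edgeFinset → ℕ} {z t x : V} {δ : XState G}
    {n₂ : Current G} (hδ : explore rk n₂ {t} z = δ) {n₁ : Current G}
    (h : (n₁, n₂) ∈ tracedConn G x z) :
    ∃ w ∈ backboneNbhd δ, onEdges δ.usedᶜ n₂ + n₁ ∈ connIn (cutGraph G δ.used) x w := by
  rw [mem_tracedConn_iff] at h
  obtain ⟨p⟩ := h
  have hz : z ∈ backboneNbhd δ := mem_backboneNbhd_of_mem_vis (hδ ▸ start_mem_vis_explore z)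
  have hadj : ∀ a b, (openGraph (n₁ + n₂).traced).Adj a b → a ∉ backboneNbhd δ →
      (openGraph ((onEdges δ.usedᶜ n₂ + n₁).tracedIn (cutGraph G δ.used))).Adj a b := by
    intro a b hab ha
    rw [openGraph_adj] at hab ⊢
    obtain ⟨⟨he, hpos⟩, hne⟩ := hab
    set e : G.edgeFinset := ⟨s(a, b), he⟩ with he_def
    have heD : e ∉ δ.used := fun hmem =>
      ha (mem_backboneNbhd_of_mem_used hmem (by rw [he_def]; exact Sym2.mem_mk_left a b))
    refine ⟨⟨?_, ?_⟩, hne⟩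
    · -- an edge of the cut graph
      have : (e : Sym2 V) ∈ (cutGraph G δ.used).edgeFinset := (coe_mem_cutGraph_edgeFinset_iff e).2 heD
      exact SimpleGraph.mem_edgeFinset.1 this
    · -- carrying positive current `n₂|_{Dᶜ} + n₁`
      change (e : Sym2 V) ∈ (onEdges δ.usedᶜ n₂ + n₁).traced
      rw [Current.mem_traced_iff]
      simp only [Pi.add_apply] at hpos ⊢
      rw [onEdges_apply_of_mem _ (Finset.mem_compl.2 heD)]
      omega
  obtain ⟨w, hw, hr⟩ := exists_mem_reachable_of_walk hadj p hz
  exact ⟨w, hw, (mem_connIn_iff _).2 hr⟩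

/-- Fubini bookkeeping for the conditional pair sums (pure `ℝ≥0∞` algebra):
`Σ_n f(n)·(a·Σ_m g(m)·Σ_{w∈W} h_w(m,n)) = a·Σ_{w∈W} Σ_{(m,n)} g(m) f(n) h_w(m,n)`. [folklore] -/
theorem tsum_mul_mul_tsum_mul_sum_eq {ι κ : Type*} (W : Finset κ) (a : ℝ≥0∞) (f g : ι → ℝ≥0∞)
    (h : κ → ι → ι → ℝ≥0∞) :
    ∑' n, f n * (a * ∑' m, g m * ∑ w ∈ W, h w m n) =
      a * ∑ w ∈ W, ∑' q : ι × ι, g q.1 * f q.2 * h w q.1 q.2 := by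
  have hL : ∀ n, f n * (a * ∑' m, g m * ∑ w ∈ W, h w m n) =
      ∑' m, ∑ w ∈ W, a * (g m * f n * h w m n) := by
    intro n
    rw [mul_left_comm, ← ENNReal.tsum_mul_left, ← ENNReal.tsum_mul_left]
    refine tsum_congr fun m => ?_
    rw [Finset.mul_sum, Finset.mul_sum, Finset.mul_sum]
    refine Finset.sum_congr rfl fun w _ => ?_
    ring
  calc ∑' n, f n * (a * ∑' m, g m * ∑ w ∈ W, h w m n)
      = ∑' n, ∑' m, ∑ w ∈ W, a * (g m * f n * h w m n) := tsum_congr hL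
    _ = ∑' m, ∑' n, ∑ w ∈ W, a * (g m * f n * h w m n) := ENNReal.tsum_comm
    _ = ∑' m, ∑ w ∈ W, ∑' n, a * (g m * f n * h w m n) :=
        tsum_congr fun m => Summable.tsum_finsetSum (fun _ _ => ENNReal.summable)
    _ = ∑ w ∈ W, ∑' m, ∑' n, a * (g m * f n * h w m n) :=
        Summable.tsum_finsetSum (fun _ _ => ENNReal.summable)
    _ = ∑ w ∈ W, ∑' q : ι × ι, a * (g q.1 * f q.2 * h w q.1 q.2) :=
        Finset.sum_congr rfl fun w _ => ENNReal.tsum_prod.symm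
    _ = a * ∑ w ∈ W, ∑' q : ι × ι, g q.1 * f q.2 * h w q.1 q.2 := by
        rw [Finset.mul_sum]
        exact Finset.sum_congr rfl fun w _ => ENNReal.tsum_mul_left

/-! ### The necessary condition, one backbone state at a time -/

/-- **One backbone state, upper bound**: for `δ ∈ finalStates rk {t} z t`,
`Σ_{n₁} Σ_{n₂ ∈ Cyl(δ)} w(n₁) w(n₂) 1[x ↔ z in n₁+n₂] ≤ patSum(δ) · cutFirstMoment K δ.used (backboneNbhd δ) x y`
(first entrance + functional chain rule + exact cut one-point function). [cite: AizenmanCMP1982, Prop. 9.2] -/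
theorem tsum_inCyl_conn_le_patSum_mul_cutFirstMoment {β : ℝ} (hβ : 0 ≤ β) {rk : G.edgeFinset → ℕ}
    (hrk : Function.Injective rk) (x y z t : V) {δ : XState G} (hδ : δ ∈ finalStates rk {t} z t) :
    ∑' n₁ : Current G, ∑' n₂ : Current G,
        (if n₁.sources = {x} ∆ {y} then n₁.eweight (fun _ => β) else 0) *
          ((if n₂.sources = {z} ∆ {t} then n₂.eweight (fun _ => β) else 0) *
            (if InCyl δ n₂ then 1 else 0)) *
          (tracedConn G x z).indicator 1 (n₁, n₂) ≤
      patSum (fun _ => β) δ * cutFirstMoment (fun _ => β) δ.used (backboneNbhd δ) x y := by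
  set K : G.edgeFinset → ℝ := fun _ => β with hKdef
  have hK : ∀ e, 0 ≤ K e := fun _ => hβ
  obtain ⟨-, n₀, hδ'⟩ := mem_finalStates_iff.1 hδ
  have h0 : ({z} ∆ {t}) ∆ ({z} ∆ {t}) = (∅ : Finset V) := by rw [symmDiff_self]; rfl
  set W := backboneNbhd δ with hW
  -- the contact count on the neighbourhood, as a function of the off-part
  set H : Current G → Current G → ℝ≥0∞ := fun n₁ m =>
    ∑ w ∈ W, (connIn (cutGraph G δ.used) x w).indicator 1 (m + n₁) with hH
  -- termwise: first entrance
  have hterm : ∀ n₁ n₂ : Current G,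
      (if n₁.sources = {x} ∆ {y} then n₁.eweight K else 0) *
          ((if n₂.sources = {z} ∆ {t} then n₂.eweight K else 0) * (if InCyl δ n₂ then 1 else 0)) *
          (tracedConn G x z).indicator 1 (n₁, n₂) ≤
        (if n₁.sources = {x} ∆ {y} then n₁.eweight K else 0) *
          ((if n₂.sources = {z} ∆ {t} ∧ InCyl δ n₂ then n₂.eweight K else 0) *
            H n₁ (onEdges δ.usedᶜ n₂)) := by
    intro n₁ n₂
    by_cases hB : n₂.sources = {z} ∆ {t} ∧ InCyl δ n₂
    · rw [if_pos hB, if_pos hB.1, if_pos hB.2, mul_one, mul_assoc]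
      refine mul_le_mul' le_rfl (mul_le_mul' le_rfl ?_)
      by_cases hp : (n₁, n₂) ∈ tracedConn G x z
      · have hex : explore rk n₂ {t} z = δ := by
          rw [hδ']; exact (explore_eq_iff_inCyl hrk).2 (hδ' ▸ hB.2)
        obtain ⟨w, hw, hmem⟩ := exists_mem_backboneNbhd_connIn hex hp
        rw [Set.indicator_of_mem hp, Pi.one_apply]
        refine le_trans ?_ (Finset.single_le_sum (f := fun w =>
          (connIn (cutGraph G δ.used) x w).indicator (1 : Current G → ℝ≥0∞) (onEdges δ.usedᶜ n₂ + n₁))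
          (fun _ _ => bot_le) hw)
        rw [Set.indicator_of_mem hmem, Pi.one_apply]
      · rw [Set.indicator_of_notMem hp]; exact bot_le
    · have h2 : (if n₂.sources = {z} ∆ {t} then n₂.eweight K else 0) * (if InCyl δ n₂ then 1 else 0) = 0 := by
        by_cases hs : n₂.sources = {z} ∆ {t}
        · have hc : ¬ InCyl δ n₂ := fun hc => hB ⟨hs, hc⟩
          rw [if_neg hc, mul_zero]
        · rw [if_neg hs, zero_mul]
      rw [h2, mul_zero, zero_mul]
      exact bot_le
  calc ∑' n₁ : Current G, ∑' n₂ : Current G,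
        (if n₁.sources = {x} ∆ {y} then n₁.eweight K else 0) *
          ((if n₂.sources = {z} ∆ {t} then n₂.eweight K else 0) * (if InCyl δ n₂ then 1 else 0)) *
          (tracedConn G x z).indicator 1 (n₁, n₂)
      ≤ ∑' n₁ : Current G, ∑' n₂ : Current G,
          (if n₁.sources = {x} ∆ {y} then n₁.eweight K else 0) *
            ((if n₂.sources = {z} ∆ {t} ∧ InCyl δ n₂ then n₂.eweight K else 0) *
              H n₁ (onEdges δ.usedᶜ n₂)) :=
        ENNReal.tsum_le_tsum fun n₁ => ENNReal.tsum_le_tsum fun n₂ => hterm n₁ n₂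
    _ = ∑' n₁ : Current G, (if n₁.sources = {x} ∆ {y} then n₁.eweight K else 0) *
          (patSum K δ * ∑' m : Current G,
            (if IsSupp (cutGraph G δ.used) m ∧ m.sources = ({z} ∆ {t}) ∆ ({z} ∆ {t})
              then m.eweight K else 0) * H n₁ m) := by
        refine tsum_congr fun n₁ => ?_
        rw [ENNReal.tsum_mul_left, tsum_sources_inCyl_mul_eq_of_mem_finalStates hK hrk hδ ({z} ∆ {t}) (H n₁)]
    _ = patSum K δ * ∑ w ∈ W, ∑' q : Current G × Current G,
          cutPairWeight K δ.used x y q * (connIn (cutGraph G δ.used) x w).indicator 1 (q.1 + q.2) := by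
        rw [h0]
        exact tsum_mul_mul_tsum_mul_sum_eq W (patSum K δ) _ _
          (fun w m n => (connIn (cutGraph G δ.used) x w).indicator 1 (m + n))
    _ = patSum K δ * cutFirstMoment K δ.used W x y := by
        congr 1
        unfold cutFirstMoment
        exact Finset.sum_congr rfl fun w _ => tsum_cutPairWeight_mul_indicator_connIn hK δ.used x y w

/-! ### The necessary condition -/

/-- **The exact necessary condition of the line `partner-backbone-cut`** (finite graph, `β ≥ 0`,
injective ranking): `P^{xy,zt}[x ↔ z] · Z[xy]Z[zt] ≤ Σ_{δ ∈ finalStates(z→t)} patSum(δ) ·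
Σ_{w ∈ backboneNbhd δ} Z_{H_δ}[{x}Δ{w}] Z[{y}Δ{w}]`, i.e.
`P[x ↔ z] ≤ E^{zt}[ Σ_{w ∈ W_δ} ⟨σ_xσ_w⟩_{H_δ} ⟨σ_wσ_y⟩ / ⟨σ_xσ_y⟩ ]`: Aizenman's intersection
probability is at most the expected CUT `σσ`-capacity of the 1-neighbourhood of the partner's
explored backbone. Consequently any proof of the crux (`P[x ↔ z] ≥ c` at macroscopic separation,
Disproof §C) forces that capacity to stay `≥ c · ⟨σ_xσ_y⟩` in mean — clause (B1) of Stub 4 is necessary.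
(Refines Aizenman 1982 Prop. 5.1 / the tree-diagram bound, which follows by `Z_{H_δ} ≤ Z` and the
chain rule for backbones.) [cite: AizenmanCMP1982, §5 Prop. 5.1 and §9 Prop. 9.2] -/
theorem connMass_le_sum_cutFirstMoment_nbhd {β : ℝ} (hβ : 0 ≤ β) {rk : G.edgeFinset → ℕ}
    (hrk : Function.Injective rk) (x y z t : V) :
    connMass G β x y z t ≤
      ∑ δ ∈ finalStates rk {t} z t,
        patSum (fun _ => β) δ * cutFirstMoment (fun _ => β) δ.used (backboneNbhd δ) x y := by
  rw [connMass_eq_sum_finalStates hβ hrk x y z t]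
  exact Finset.sum_le_sum fun δ hδ => tsum_inCyl_conn_le_patSum_mul_cutFirstMoment hβ hrk x y z t hδ


/-- **Registered calibration sub-goal `stub_backboneCutNecessary`** (explicit form of
`connMass_le_sum_cutFirstMoment_nbhd`, the exact necessary condition of the line): for every finite
graph, `β ≥ 0`, injective ranking and vertices `x y z t`,
`connMass ≤ Σ_{δ ∈ finalStates(z→t)} patSum(δ) · cutFirstMoment(δ.used, backboneNbhd δ)`.
[cite: AizenmanCMP1982, §5 Prop. 5.1 and §9 Prop. 9.2] -/
theorem stub_backboneCutNecessary :
    ∀ (V : Type) [Fintype V] [DecidableEq V] (G : SimpleGraph V) [DecidableRel G.Adj] (β : ℝ), 0 ≤ β →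
      ∀ (rk : G.edgeFinset → ℕ), Function.Injective rk → ∀ (x y z t : V),
        connMass G β x y z t ≤ ∑ δ ∈ Current.finalStates rk {t} z t,
          patSum (fun _ => β) δ * cutFirstMoment (fun _ => β) δ.used (backboneNbhd δ) x y :=
  fun _ _ _ _ _ _ hβ _ hrk x y z t => connMass_le_sum_cutFirstMoment_nbhd hβ hrk x y z t

end Summit.CriticalPhenomena.Ising3DConformalLimit.Cruxes.IsingEuclidUpgradeR4NonGaussian.PartnerBackboneCut
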